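import Summits.BirchSwinnertonDyer.BirchSwinnertonDyer.Theorems.PrintCFramBottomClassIndexLawFiveLeBorelDescentData
import HarnessLib

/-!
# Route `PrintCFram`, crux C2 `BottomClassIndexLawFiveLe` (stmt-BirchSwinnertonDyer-20372), line
# `eisenstein-resource-bdp-line`, stub `stub_kolyvaginUpper_borelCM_pairSum_offKrizLi`:
# **CLAIM A ON `H¹(K, W[p^M])` AT THE BOREL CM-RAMIFIED PRIME: `p^{M₀+1}·Sel^{−ε} = 0`, and `p^{M₀}` on
# even-depth classes**
# (cell `bsd-print-cfram`, seat `bsd-line-cfram-p1-w2` g7; helper `--supports` 20372; 0 facts, 0 defs, 0 sorry)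

HONEST FRAMING. Nothing about BSD is proved here, and nothing of the stub itself. The abstract Claim A at the Borel
prime (`…BorelDescentClaimA.claimA_borel`, `claimA_borel_of_even`) instantiated on `H¹(K, W[p^M])` through the
package `exists_borelCebotarevData_of_cmRamified` (`…BorelDescentData`): for the CM class at the ramified prime with
line sign `ε` and the displayed Euler-system leaves (`c(1) = p^{M₀}x`, Prop. 5.4 (2), Lemma 4.3, Prop. 4.4, Lemma
5.3 + Prop. 2.2, as in `…BorelDescentAssembly`):

* **`pow_zsmul_eq_zero_of_neg_eigen_of_cmRamified`** — `p^{M₀+1} s = 0` for every `s ∈ Sel` with `c_* s = −ε s`;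
* **`pow_zsmul_eq_zero_of_neg_eigen_of_cmRamified_of_even`** — `p^{M₀} s = 0` if moreover `s` has an EVEN exact
  `𝓞`-depth (McCallum's Claim A verbatim; the lost step is confined to odd-depth `(−ε)`-classes, the depth-1 ones —
  the `φ`-Selmer side of the rank-zero twist — being blind, w2 g6).

THEOREMS ONLY; no definition, no named fact introduced, no `sorry`. BSD is not proved by any of this; no summit
statement is proved by this seat. References: [GrossLMS1991] §10 Claim 10.1; [McCallumLMS1991] §5.
-/

set_option autoImplicit false
-- `…BirchSwinnertonDyer.BirchSwinnertonDyer.Theorems…` is the problem's mandated namespace (D-0017).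
set_option linter.dupNamespace false

noncomputable section

open scoped Classical

namespace Summit.BirchSwinnertonDyer.BirchSwinnertonDyer.Theorems.PrintCFram.BorelKolyvaginPairing

open WeierstrassCurve NumberField IsDedekindDomain Field Literature.NumberTheory.EllipticCurves
  Literature.NumberTheory.GaloisRepresentations Literature.NumberTheory.EllipticCurves.Rank1Residual
  Literature.NumberTheory.EllipticCurves.KolyvaginDescent
  Summit.BirchSwinnertonDyer.BirchSwinnertonDyer.Theorems.PrintCFram.BorelHomothety
  Summit.BirchSwinnertonDyer.BirchSwinnertonDyer.Theorems.PrintCFram.BorelDescent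

variable (W : WeierstrassCurve ℚ) [W.IsElliptic] (p : ℕ) [hp : Fact p.Prime]
variable {K : Type} [Field K] [NumberField K] {Pl : Type*}

/-- **Claim A on `H¹(K, W[p^M])` at the Borel prime: `p^{M₀+1} s = 0` for `s ∈ Sel^{−ε}`.**
[cite: GrossLMS1991, §10 Claim 10.1] [cite: McCallumLMS1991, §5] -/
theorem pow_zsmul_eq_zero_of_neg_eigen_of_cmRamified
    (hC : Literature.NumberTheory.Automorphic.chebotarev_artinRep) {N : ℕ} [NeZero N]
    (hCM : W.HasCM) (h5 : 5 ≤ p) (hram : CMRamified W p)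
    {s₀ : AlgebraicClosure ℚ} {μ : AddMonoid.End W.geomPoints} {m : ℤ}
    (hs : s₀ ^ 2 = ((-(p : ℤ) : ℤ) : AlgebraicClosure ℚ)) (hm : m.natAbs = p)
    (hμμ : ∀ P, μ (μ P) = m • P)
    (hcomm : ∀ g : absoluteGaloisGroup ℚ, g • s₀ = s₀ → ∀ P, μ (g • P) = g • μ P)
    (hanti : ∀ g : absoluteGaloisGroup ℚ, g • s₀ = -s₀ → ∀ P, μ (g • P) = -(g • μ P))
    (hK : IsImaginaryQuadratic K) (hKp : ∀ y : K, y ^ 2 ≠ -(p : K)) {M : ℕ} (hM : 1 ≤ M)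
    {cK : K ≃ₐ[ℚ] K} {c₀ : absoluteGaloisGroup ℚ} (hc₀ : IsComplexConjugation (Rat.castHom ℝ) c₀)
    (ht : IsLiftOfAut cK (absGaloisTransport (K := ℚ) (L := K) c₀).toRingEquiv)
    {ε : ℤ} (hε : ε = 1 ∨ ε = -1) (hη : ∀ P : W.geomPoints, μ P = 0 → c₀ • P = ε • P)
    -- the displayed non-Čebotarev data on `V = H¹(K, W[p^M])`
    (Sel : AddSubgroup (galH1Torsion (W.baseChange K) ((p ^ M : ℕ) : ℤ)))
    (Loc : Pl → AddSubgroup (galH1Torsion (W.baseChange K) ((p ^ M : ℕ) : ℤ)))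
    (pl : ℕ → Pl) (Dv : Pl → ℕ → Prop)
    (hdv : ∀ ℓ, (IsKolyvaginPrime N W K p ℓ ∧ FrobEqFrobInfty W K (p ^ M) ℓ) → ∀ v, Dv v ℓ ↔ v = pl ℓ)
    {xc : galH1Torsion (W.baseChange K) ((p ^ M : ℕ) : ℤ)}
    (hxord : ((p : ℤ) ^ (M - 1)) • xc ≠ 0) (hτx : conjAct W cK ((p ^ M : ℕ) : ℤ) xc = ε • xc) {M₀ : ℕ}
    (cl : ℕ → galH1Torsion (W.baseChange K) ((p ^ M : ℕ) : ℤ)) (hc1 : cl 1 = ((p : ℤ) ^ M₀) • xc)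
    (hτc : ∀ n, KolSupp (fun ℓ ↦ IsKolyvaginPrime N W K p ℓ ∧ FrobEqFrobInfty W K (p ^ M) ℓ) n →
      conjAct W cK ((p ^ M : ℕ) : ℤ) (cl n) = (ε * (-1) ^ n.primeFactors.card) • cl n)
    (hcloc : ∀ n, KolSupp (fun ℓ ↦ IsKolyvaginPrime N W K p ℓ ∧ FrobEqFrobInfty W K (p ^ M) ℓ) n →
      ∀ v, ¬ Dv v n → cl n ∈ Loc v)
    (hc44 : ∀ ℓ n, (IsKolyvaginPrime N W K p ℓ ∧ FrobEqFrobInfty W K (p ^ M) ℓ) →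
      KolSupp (fun ℓ ↦ IsKolyvaginPrime N W K p ℓ ∧ FrobEqFrobInfty W K (p ^ M) ℓ) (ℓ * n) → ∀ a : ℕ,
      (((p : ℤ) ^ a) • cl (ℓ * n) ∈ Loc (pl ℓ)) ↔
        ((p : ℤ) ^ a) • cl n ∈ ⨅ (v : HeightOneSpectrum (𝓞 K)) (_ : (ℓ : 𝓞 K) ∈ v.asIdeal),
          (W.baseChange K).torsionLocalKer (v.adicCompletion K) ((p ^ M : ℕ) : ℤ))
    (hdual : ∀ ℓ, (IsKolyvaginPrime N W K p ℓ ∧ FrobEqFrobInfty W K (p ^ M) ℓ) → ∀ ν : ℤ,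
      (ν = 1 ∨ ν = -1) → ∀ d, conjAct W cK ((p ^ M : ℕ) : ℤ) d = ν • d → (∀ v, v ≠ pl ℓ → d ∈ Loc v) →
      ∀ s ∈ Sel, conjAct W cK ((p ^ M : ℕ) : ℤ) s = ν • s → ∀ a, a < M →
      ((p : ℤ) ^ a) • d ∉ Loc (pl ℓ) →
        ((p : ℤ) ^ (M - 1 - a)) • s ∈ ⨅ (v : HeightOneSpectrum (𝓞 K)) (_ : (ℓ : 𝓞 K) ∈ v.asIdeal),
          (W.baseChange K).torsionLocalKer (v.adicCompletion K) ((p ^ M : ℕ) : ℤ))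
    {s : galH1Torsion (W.baseChange K) ((p ^ M : ℕ) : ℤ)} (hsSel : s ∈ Sel)
    (hτs : conjAct W cK ((p ^ M : ℕ) : ℤ) s = (-ε) • s) :
    ((p : ℤ) ^ (M₀ + 1)) • s = 0 := by
  obtain ⟨dp, TopIndep, hdp, -, -, -, hceb2, -⟩ :=
    exists_borelCebotarevData_of_cmRamified W p hC (N := N) hCM h5 hram hs hm hμμ hcomm hanti hK hKp hM hc₀ ht hε hη
      hxord hτx
  have htor : ∀ v : galH1Torsion (W.baseChange K) ((p ^ M : ℕ) : ℤ), ((p : ℤ) ^ M) • v = 0 := fun v ↦ by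
    have := zsmul_discreteH1_torsion ((p ^ M : ℕ) : ℤ) v
    exact_mod_cast this
  have hKolp : ∀ ℓ, (IsKolyvaginPrime N W K p ℓ ∧ FrobEqFrobInfty W K (p ^ M) ℓ) → ℓ.Prime :=
    fun ℓ h ↦ h.1.prime
  exact claimA_borel
    (Kol := fun ℓ ↦ IsKolyvaginPrime N W K p ℓ ∧ FrobEqFrobInfty W K (p ^ M) ℓ)
    (A := fun ℓ ↦ ⨅ (v : HeightOneSpectrum (𝓞 K)) (_ : (ℓ : 𝓞 K) ∈ v.asIdeal),
      (W.baseChange K).torsionLocalKer (v.adicCompletion K) ((p ^ M : ℕ) : ℤ))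
    (dp := dp) hε htor hKolp hdv hxord hτx hc1 hτc hcloc hc44 hdual hdp hceb2 hsSel hτs

/-- **McCallum's Claim A verbatim on even-depth classes: `p^{M₀} s = 0`** for `s ∈ Sel^{−ε}` with an EVEN exact
`𝓞`-depth `e` (`μ^e` kills the values of `s`, `μ^{e−1}` does not). [cite: GrossLMS1991, §10 Claim 10.1] -/
theorem pow_zsmul_eq_zero_of_neg_eigen_of_cmRamified_of_even
    (hC : Literature.NumberTheory.Automorphic.chebotarev_artinRep) {N : ℕ} [NeZero N]
    (hCM : W.HasCM) (h5 : 5 ≤ p) (hram : CMRamified W p)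
    {s₀ : AlgebraicClosure ℚ} {μ : AddMonoid.End W.geomPoints} {m : ℤ}
    (hs : s₀ ^ 2 = ((-(p : ℤ) : ℤ) : AlgebraicClosure ℚ)) (hm : m.natAbs = p)
    (hμμ : ∀ P, μ (μ P) = m • P)
    (hcomm : ∀ g : absoluteGaloisGroup ℚ, g • s₀ = s₀ → ∀ P, μ (g • P) = g • μ P)
    (hanti : ∀ g : absoluteGaloisGroup ℚ, g • s₀ = -s₀ → ∀ P, μ (g • P) = -(g • μ P))
    (hK : IsImaginaryQuadratic K) (hKp : ∀ y : K, y ^ 2 ≠ -(p : K)) {M : ℕ} (hM : 1 ≤ M)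
    {cK : K ≃ₐ[ℚ] K} {c₀ : absoluteGaloisGroup ℚ} (hc₀ : IsComplexConjugation (Rat.castHom ℝ) c₀)
    (ht : IsLiftOfAut cK (absGaloisTransport (K := ℚ) (L := K) c₀).toRingEquiv)
    {ε : ℤ} (hε : ε = 1 ∨ ε = -1) (hη : ∀ P : W.geomPoints, μ P = 0 → c₀ • P = ε • P)
    -- the displayed non-Čebotarev data on `V = H¹(K, W[p^M])`
    (Sel : AddSubgroup (galH1Torsion (W.baseChange K) ((p ^ M : ℕ) : ℤ)))
    (Loc : Pl → AddSubgroup (galH1Torsion (W.baseChange K) ((p ^ M : ℕ) : ℤ)))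
    (pl : ℕ → Pl) (Dv : Pl → ℕ → Prop)
    (hdv : ∀ ℓ, (IsKolyvaginPrime N W K p ℓ ∧ FrobEqFrobInfty W K (p ^ M) ℓ) → ∀ v, Dv v ℓ ↔ v = pl ℓ)
    {xc : galH1Torsion (W.baseChange K) ((p ^ M : ℕ) : ℤ)}
    (hxord : ((p : ℤ) ^ (M - 1)) • xc ≠ 0) (hτx : conjAct W cK ((p ^ M : ℕ) : ℤ) xc = ε • xc) {M₀ : ℕ}
    (cl : ℕ → galH1Torsion (W.baseChange K) ((p ^ M : ℕ) : ℤ)) (hc1 : cl 1 = ((p : ℤ) ^ M₀) • xc)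
    (hτc : ∀ n, KolSupp (fun ℓ ↦ IsKolyvaginPrime N W K p ℓ ∧ FrobEqFrobInfty W K (p ^ M) ℓ) n →
      conjAct W cK ((p ^ M : ℕ) : ℤ) (cl n) = (ε * (-1) ^ n.primeFactors.card) • cl n)
    (hcloc : ∀ n, KolSupp (fun ℓ ↦ IsKolyvaginPrime N W K p ℓ ∧ FrobEqFrobInfty W K (p ^ M) ℓ) n →
      ∀ v, ¬ Dv v n → cl n ∈ Loc v)
    (hc44 : ∀ ℓ n, (IsKolyvaginPrime N W K p ℓ ∧ FrobEqFrobInfty W K (p ^ M) ℓ) →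
      KolSupp (fun ℓ ↦ IsKolyvaginPrime N W K p ℓ ∧ FrobEqFrobInfty W K (p ^ M) ℓ) (ℓ * n) → ∀ a : ℕ,
      (((p : ℤ) ^ a) • cl (ℓ * n) ∈ Loc (pl ℓ)) ↔
        ((p : ℤ) ^ a) • cl n ∈ ⨅ (v : HeightOneSpectrum (𝓞 K)) (_ : (ℓ : 𝓞 K) ∈ v.asIdeal),
          (W.baseChange K).torsionLocalKer (v.adicCompletion K) ((p ^ M : ℕ) : ℤ))
    (hdual : ∀ ℓ, (IsKolyvaginPrime N W K p ℓ ∧ FrobEqFrobInfty W K (p ^ M) ℓ) → ∀ ν : ℤ,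
      (ν = 1 ∨ ν = -1) → ∀ d, conjAct W cK ((p ^ M : ℕ) : ℤ) d = ν • d → (∀ v, v ≠ pl ℓ → d ∈ Loc v) →
      ∀ s ∈ Sel, conjAct W cK ((p ^ M : ℕ) : ℤ) s = ν • s → ∀ a, a < M →
      ((p : ℤ) ^ a) • d ∉ Loc (pl ℓ) →
        ((p : ℤ) ^ (M - 1 - a)) • s ∈ ⨅ (v : HeightOneSpectrum (𝓞 K)) (_ : (ℓ : 𝓞 K) ∈ v.asIdeal),
          (W.baseChange K).torsionLocalKer (v.adicCompletion K) ((p ^ M : ℕ) : ℤ))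
    {s : galH1Torsion (W.baseChange K) ((p ^ M : ℕ) : ℤ)} (hsSel : s ∈ Sel)
    (hτs : conjAct W cK ((p ^ M : ℕ) : ℤ) s = (-ε) • s) {e : ℕ} (heven : Even e)
    (hse : ∀ ρ ∈ torsionFixing (W.baseChange K) ((p ^ M : ℕ) : ℤ), (μ ^ e) ((RatClosure.torsionEquiv (K := K) W ((p ^ M : ℕ) : ℤ)).symm
          (h1Eval (W.baseChange K) ((p ^ M : ℕ) : ℤ) s ρ) : W.geomPoints) = 0)
    (hstop : ∃ ρ ∈ torsionFixing (W.baseChange K) ((p ^ M : ℕ) : ℤ), (μ ^ (e - 1)) ((RatClosure.torsionEquiv (K := K) W ((p ^ M : ℕ) : ℤ)).symm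
          (h1Eval (W.baseChange K) ((p ^ M : ℕ) : ℤ) s ρ) : W.geomPoints) ≠ 0) :
    ((p : ℤ) ^ M₀) • s = 0 := by
  obtain ⟨dp, TopIndep, hdp, hdpeq, -, -, hceb2, -⟩ :=
    exists_borelCebotarevData_of_cmRamified W p hC (N := N) hCM h5 hram hs hm hμμ hcomm hanti hK hKp hM hc₀ ht hε hη
      hxord hτx
  have htor : ∀ v : galH1Torsion (W.baseChange K) ((p ^ M : ℕ) : ℤ), ((p : ℤ) ^ M) • v = 0 := fun v ↦ by
    have := zsmul_discreteH1_torsion ((p ^ M : ℕ) : ℤ) v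
    exact_mod_cast this
  have hKolp : ∀ ℓ, (IsKolyvaginPrime N W K p ℓ ∧ FrobEqFrobInfty W K (p ^ M) ℓ) → ℓ.Prime :=
    fun ℓ h ↦ h.1.prime
  have hde : Even (dp s) := by rw [hdpeq s e hse hstop]; exact heven
  exact claimA_borel_of_even
    (Kol := fun ℓ ↦ IsKolyvaginPrime N W K p ℓ ∧ FrobEqFrobInfty W K (p ^ M) ℓ)
    (A := fun ℓ ↦ ⨅ (v : HeightOneSpectrum (𝓞 K)) (_ : (ℓ : 𝓞 K) ∈ v.asIdeal),
      (W.baseChange K).torsionLocalKer (v.adicCompletion K) ((p ^ M : ℕ) : ℤ))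
    (dp := dp) hε htor hKolp hdv hxord hτx hc1 hτc hcloc hc44 hdual hdp hceb2 hsSel hτs hde

end Summit.BirchSwinnertonDyer.BirchSwinnertonDyer.Theorems.PrintCFram.BorelKolyvaginPairing

end
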